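import Literature.MathematicalPhysics.QuantumFieldTheory.MassGapFromDiagonalClustering
import HarnessLib

/-!
# Diagonal clustering of a lattice approximation (free constants): the named lattice interface

Topic `MathematicalPhysics/QuantumFieldTheory` (families `constructive-qft`, `yang-mills`); the named
form of the hypothesis of `OSData.hasMassGap_of_tendsto_of_diagBound` (`MassGapFromDiagonalClustering`),
parallel to `ClustersCS` / `SpeciesScheme.HasCSClustering` / `QCDScheme.HasSpeciesCSClustering` of
`MassGapFromLatticeClustering`.

* `ClustersDiag d Λ Δ` — for every arity `n ≥ 1`, label string `σ` and ONE slab-ordered real factor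
  datum `p` there is a constant `C` such that for all `t ≥ 0`, `ε > 0`, EVENTUALLY in `k`,
  `‖Λᵏ₂ₙ(θpʳ ++ T_t p) − Λᵏₙ(θpʳ) Λᵏₙ(p)‖ ≤ C e^{−Δt} + ε` (the diagonal `N = N' = 1`, `c = 1`
  instance of `ClustersCS` with the Cauchy–Schwarz right-hand side replaced by a FREE constant).
* `OSData.hasMassGap_of_clustersDiag` — convergence on off-diagonal real product tensors + `ClustersDiag`
  ⇒ `T.HasMassGap Δ` (`d ≥ 2`).
* `clustersDiag_of_clustersCS` — given the convergence, `ClustersCS` implies `ClustersDiag`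
  (constant `‖𝔖₂ₙ(ΘP* ⊗ P)‖ + 1`): the diagonal interface is the WEAKER lattice hypothesis.
* Instances: `SpeciesScheme.HasDiagClustering` / `IsYangMillsFor.hasMassGap_of_hasDiagClustering`
  (Yang–Mills), `QCDScheme.HasSpeciesDiagClustering` / `IsQCDAlong.hasMassGap_of_hasSpeciesDiagClustering`
  (QCD).

References: J. Glimm, A. Jaffe, *Quantum Physics* (1987) §6.1 Thm. 6.1.3 [GlimmJaffeQP1987];
K. Osterwalder, E. Seiler, Ann. Phys. 110 (1978) §§2–4 [OsterwalderSeiler1978];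
A. Jaffe, E. Witten, *Quantum Yang–Mills theory* (2000) §4–§5 [JaffeWitten2000].
-/

open scoped SchwartzMap ComplexConjugate
open Filter Topology Complex Set
open Literature.MathematicalPhysics.AQFT Literature.MathematicalPhysics.QuantumLattice

noncomputable section

namespace Literature.MathematicalPhysics.QuantumFieldTheory

variable {d : ℕ} [NeZero d]

variable (d) in
/-- **Diagonal clustering at rate `Δ` of a lattice approximation `Λ`, free constants**: for every
arity `n ≥ 1`, label string `σ` and ONE slab-ordered real factor datum `p` there is a constant `C`
such that for all `t ≥ 0` and `ε > 0`, eventually in `k`,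
`‖Λᵏ₂ₙ(θpʳ ++ T_t p) − Λᵏₙ(θpʳ) Λᵏₙ(p)‖ ≤ C e^{−Δt} + ε`.  (The `N = N' = 1`, `q = p`, `c = c' = 1`
instance of `ClustersCS`, with the Cauchy–Schwarz right-hand side replaced by a free constant.)
[cite: GlimmJaffeQP1987, §6.1 Thm. 6.1.3] [cite: OsterwalderSeiler1978, §§2–4] -/
def ClustersDiag {ι : Type} (Λ : ℕ → (n : ℕ) → (Fin n → ι) →
      (Fin n → 𝓢(EuclideanSpace ℝ (Fin d), ℝ)) → ℂ) (Δ : ℝ) : Prop :=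
  ∀ (n : ℕ), n ≠ 0 → ∀ (σ : Fin n → ι) (p : Fin n → 𝓢(EuclideanSpace ℝ (Fin d), ℝ)),
    IsSlabOrdered p → ∃ C : ℝ, ∀ t : ℝ, 0 ≤ t → ∀ ε : ℝ, 0 < ε → ∀ᶠ k in atTop,
      ‖Λ k (n + n) (Fin.append (σ ∘ Fin.rev) σ)
            (Fin.append (fun l => thetaTest d (p (Fin.rev l)))
              (fun l => translateTest (EuclideanSpace.single 0 t) (p l))) -
          Λ k n (σ ∘ Fin.rev) (fun l => thetaTest d (p (Fin.rev l))) * Λ k n σ p‖ ≤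
        C * Real.exp (-Δ * t) + ε

namespace OSData

variable {ι : Type}

/-- **The transfer, diagonal form**: convergence of `Λ k` to `𝔖` on off-diagonal real product tensors
(`n ≥ 1`) and `ClustersDiag d Λ Δ` give `T.HasMassGap Δ` (`d ≥ 2`). [cite: GlimmJaffeQP1987, §6.1 Thm. 6.1.3] -/
theorem hasMassGap_of_clustersDiag (T : OSData ι d) (hd : 1 < d)
    (Λ : ℕ → (n : ℕ) → (Fin n → ι) → (Fin n → 𝓢(EuclideanSpace ℝ (Fin d), ℝ)) → ℂ)
    (hΛ : ∀ (n : ℕ), n ≠ 0 → ∀ (σ : Fin n → ι) (f : Fin n → 𝓢(EuclideanSpace ℝ (Fin d), ℝ))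
      (F : 𝓢((Fin n → EuclideanSpace ℝ (Fin d)), ℂ)), IsTensorOf F (fun i => ofRealTest (f i)) →
      IsOffDiagonal F → Tendsto (fun k => Λ k n σ f) atTop (𝓝 (T.schwinger n σ F)))
    {Δ : ℝ} (h : ClustersDiag d Λ Δ) : T.HasMassGap Δ :=
  hasMassGap_of_tendsto_of_diagBound T hd Λ hΛ h

/-- **The diagonal interface is weaker than the Cauchy–Schwarz one**: given the convergence (so that
the lattice `2n`-point "norms" `Λᵏ₂ₙ(θpʳ ++ p)` are eventually bounded by their limit `+ 1`),
`ClustersCS d Λ Δ` implies `ClustersDiag d Λ Δ` (constant `‖𝔖₂ₙ(ΘP* ⊗ P)‖ + 1`). [folklore] -/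
theorem clustersDiag_of_clustersCS (T : OSData ι d)
    (Λ : ℕ → (n : ℕ) → (Fin n → ι) → (Fin n → 𝓢(EuclideanSpace ℝ (Fin d), ℝ)) → ℂ)
    (hΛ : ∀ (n : ℕ), n ≠ 0 → ∀ (σ : Fin n → ι) (f : Fin n → 𝓢(EuclideanSpace ℝ (Fin d), ℝ))
      (F : 𝓢((Fin n → EuclideanSpace ℝ (Fin d)), ℂ)), IsTensorOf F (fun i => ofRealTest (f i)) →
      IsOffDiagonal F → Tendsto (fun k => Λ k n σ f) atTop (𝓝 (T.schwinger n σ F)))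
    {Δ : ℝ} (h : ClustersCS d Λ Δ) : ClustersDiag d Λ Δ := by
  intro n hn σ p hp
  obtain ⟨P, hP⟩ : ∃ P : 𝓢((Fin n → EuclideanSpace ℝ (Fin d)), ℂ),
      IsTensorOf P (fun l => ofRealTest (p l)) := exists_isTensorOf _
  have hPt : IsTimeOrdered P := IsTimeOrdered.of_mem_slabOrderedProducts (hp.mem_slabOrderedProducts hP)
  -- the lattice OS "norm" converges, hence is eventually bounded by its limit `+ 1`
  set V : ℝ := ‖T.schwinger (n + n) (Fin.append (σ ∘ Fin.rev) σ) ((osAdjoint P).appendTensor P)‖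
    with hV
  have hD : Tendsto (fun k => Λ k (n + n) (Fin.append (σ ∘ Fin.rev) σ)
        (Fin.append (fun l => thetaTest d (p (Fin.rev l))) p))
      atTop (𝓝 (T.schwinger (n + n) (Fin.append (σ ∘ Fin.rev) σ) ((osAdjoint P).appendTensor P))) := by
    refine hΛ (n + n) (by omega) _ _ _ ?_ ?_
    · have h1 := hP.osAdjoint.appendTensor hP
      rwa [append_ofRealTest] at h1
    · exact OSReconstructionNoE1.isOffDiagonal_appendTensor_osAdjoint hPt hPt
  have hDn : ∀ᶠ k in atTop, ‖Λ k (n + n) (Fin.append (σ ∘ Fin.rev) σ)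
      (Fin.append (fun l => thetaTest d (p (Fin.rev l))) p)‖ ≤ V + 1 :=
    (hD.norm.eventually (Iio_mem_nhds (by linarith : V < V + 1))).mono fun k hk => hk.le
  refine ⟨V + 1, fun t ht ε hε => ?_⟩
  have hcs := h n n hn hn σ σ 1 1 (fun _ => 1) (fun _ => 1) (fun _ => p) (fun _ => p)
    (fun _ => hp) (fun _ => hp) t ht ε hε
  filter_upwards [hcs, hDn] with k hk hk'
  have hk1 : ‖Λ k (n + n) (Fin.append (σ ∘ Fin.rev) σ)
        (Fin.append (fun l => thetaTest d (p (Fin.rev l)))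
          (fun l => translateTest (EuclideanSpace.single 0 t) (p l))) -
        Λ k n (σ ∘ Fin.rev) (fun l => thetaTest d (p (Fin.rev l))) * Λ k n σ p‖ ≤
      Real.exp (-Δ * t) *
        Real.sqrt ‖Λ k (n + n) (Fin.append (σ ∘ Fin.rev) σ)
          (Fin.append (fun l => thetaTest d (p (Fin.rev l))) p)‖ *
        Real.sqrt ‖Λ k (n + n) (Fin.append (σ ∘ Fin.rev) σ)
          (Fin.append (fun l => thetaTest d (p (Fin.rev l))) p)‖ + ε := by
    simpa only [Fin.sum_univ_one, map_one, one_mul] using hk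
  have hsq : Real.sqrt ‖Λ k (n + n) (Fin.append (σ ∘ Fin.rev) σ)
          (Fin.append (fun l => thetaTest d (p (Fin.rev l))) p)‖ *
        Real.sqrt ‖Λ k (n + n) (Fin.append (σ ∘ Fin.rev) σ)
          (Fin.append (fun l => thetaTest d (p (Fin.rev l))) p)‖ ≤ V + 1 := by
    rw [Real.mul_self_sqrt (norm_nonneg _)]; exact hk'
  have hexp : 0 ≤ Real.exp (-Δ * t) := (Real.exp_pos _).le
  calc _ ≤ _ := hk1
    _ ≤ (V + 1) * Real.exp (-Δ * t) + ε := by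
        rw [mul_assoc]; nlinarith [mul_le_mul_of_nonneg_left hsq hexp]

end OSData

/-! ### The two lattice gauge theories of the summit `QuantumFields` -/

/-- **Species diagonal clustering of lattice QCD along a scheme at rate `Δ`** (free constants):
`ClustersDiag` for `qcdLatticeSchwinger sch`. [cite: JaffeWitten2000, §5] -/
def QCDScheme.HasSpeciesDiagClustering {Nf : ℕ} (sch : QCDScheme Nf) (Δ : ℝ) : Prop :=
  ClustersDiag 4 (qcdLatticeSchwinger sch) Δ

/-- **Continuum gap clause of QCD from species diagonal clustering**: `IsQCDAlong sch T` and
`sch.HasSpeciesDiagClustering Δ` give `T.HasMassGap Δ`. [cite: JaffeWitten2000, §5] [cite: OsterwalderSeiler1978, §§2–4] -/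
theorem IsQCDAlong.hasMassGap_of_hasSpeciesDiagClustering {Nf : ℕ} {sch : QCDScheme Nf}
    {T : OSData (QCDField Nf) 4} (hT : IsQCDAlong sch T) {Δ : ℝ}
    (h : sch.HasSpeciesDiagClustering Δ) : T.HasMassGap Δ :=
  OSData.hasMassGap_of_clustersDiag T (by norm_num) (qcdLatticeSchwinger sch) hT.2.2 h

section YangMills

variable {G : Type} [Group G] [MeasurableSpace G] [TopologicalSpace G] [IsTopologicalGroup G]
  [CompactSpace G] [BorelSpace G]

/-- **Diagonal clustering of lattice Yang–Mills along a species scheme at rate `Δ`** (free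
constants): `ClustersDiag` for the lattice `n`-point functions `latticeSchwinger r.ρ sch` of the
smeared renormalised gauge-invariant local observables on the scheme's own tori — the weakest lattice
statement from which the continuum gap clause `T.HasMassGap Δ` of `YangMills` is read off
(`IsYangMillsFor.hasMassGap_of_hasDiagClustering`). [cite: JaffeWitten2000, §4–§5] [cite: OsterwalderSeiler1978, §§2–4] -/
def SpeciesScheme.HasDiagClustering (r : LatticeRep G) (sch : SpeciesScheme (YMSpecies G))
    (Δ : ℝ) : Prop :=
  ClustersDiag 4 (fun k n σ f => ((latticeSchwinger r.ρ sch (fun s => s.F) k n σ f : ℝ) : ℂ)) Δ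

/-- **Continuum gap clause of Yang–Mills from diagonal clustering**: `IsYangMillsFor r sch T` and
`sch.HasDiagClustering r Δ` give `T.HasMassGap Δ`. [cite: JaffeWitten2000, §4–§5] [cite: OsterwalderSeiler1978, §§2–4] -/
theorem IsYangMillsFor.hasMassGap_of_hasDiagClustering {r : LatticeRep G}
    {sch : SpeciesScheme (YMSpecies G)} {T : OSData (YMSpecies G) 4} (hT : IsYangMillsFor r sch T)
    {Δ : ℝ} (h : sch.HasDiagClustering r Δ) : T.HasMassGap Δ :=
  OSData.hasMassGap_of_clustersDiag T (by norm_num) _ hT h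

/-- Given `IsYangMillsFor`, the Cauchy–Schwarz clustering `sch.HasCSClustering r Δ` implies the
diagonal clustering `sch.HasDiagClustering r Δ`. [folklore] -/
theorem IsYangMillsFor.hasDiagClustering_of_hasCSClustering {r : LatticeRep G}
    {sch : SpeciesScheme (YMSpecies G)} {T : OSData (YMSpecies G) 4} (hT : IsYangMillsFor r sch T)
    {Δ : ℝ} (h : sch.HasCSClustering r Δ) : sch.HasDiagClustering r Δ :=
  OSData.clustersDiag_of_clustersCS T _ hT h

end YangMills

end Literature.MathematicalPhysics.QuantumFieldTheory

end
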